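import Mathlib
import HarnessLib
import Literature.MathematicalPhysics.QuantumFieldTheory.Balaban1983to89.B10

/-!
# `Balaban1983to89.B10Decomposition7` — the decomposition of unity **(7)** and its partial resummation **(8)** of
T. Bałaban, *Ultraviolet stability of three-dimensional lattice pure gauge field theories*, Commun. Math. Phys.
**102**, 255–275 (1985) [Balaban1985UV3], as EXACT finite identities

(Cell numbering B10; journal page = PDF page + 254; read from the page renders
`run/shared/lean/pub/pub-balaban/b2b-balaban-ref1/pages/1985-cmp102-uv-stability-3d/1985-cmp102-uv-stability-3d-p003-x2.png`
(p. 257) and `…-p004-x2.png` (p. 258), re-opened 2026-08-21 for this file.)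

HONEST FRAMING (mega-formalization `lit-balaban`, verbatim): statement-level skeleton of published theorems with
citation tags; proofs where landed; nothing here is a claim about the Yang–Mills mass gap.

PDF held: `paper:balaban1985-cmp102-uv-stability-3d` (journal page = PDF page + 254).

WHAT IS REPRODUCED (SKELETON rows B10.Eq7 and B10.Eq8 of `run/shared/lean/pub/lit-balaban/SKELETON.md` §B10; Phase-2
seat p23 of `PHASE2-TARGETS.md` §G.3, taken by the nominating reader r07, unit `lit-balaban-r07` gen 3):
* p. 257 [3] **(7)**, verbatim: *"We introduce the decomposition of unity
  1 = Σ_P Π_{p∈P} χ({|U(∂p) − 1| ≥ ε₁}) Π_{p∈Pᶜ} χ({|U(∂p) − 1| < ε₁}), (7)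
  where the sum is over sets P of plaquettes of the lattice T."* — PROVED as the finite identity
  `Σ_{P ⊆ T} Π_{p∈P} χ_≥(p) · Π_{p∈T∖P} χ_<(p) = Π_{p∈T} (χ_≥(p) + χ_<(p)) = 1` over any commutative semiring
  (`decomposition7`; take the semiring of real functions of the configuration U to read it as an identity between
  functions of U), together with its pointwise content for the two complementary characteristic functions: exactly the
  term labelled by the large-field set `P = {p ∈ T : |U(∂p) − 1| ≥ ε₁}` of the configuration survives
  (`term7_indicator`, `decomposition7_indicator`; the printed window `ε₁ = g₀p(g₀)` is `B10.pFun`: `decomposition7_eps1`).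
* p. 257 [3] – p. 258 [4], verbatim: *"to each term of the decomposition we assign a subset Ω₁ ⊂ T₁ defined as a union
  of big blocks, i.e. blocks of the size M₁, of the unit lattice T₁, such that their distances to P are > RM₁. … By
  this definition p ⊂ Ω₁ᶜ, in fact dist(P, Ω₁) > RM₁ … Now we perform a partial resummation over all P determining the
  same domain Ω₁, and we write the decomposition (7) as 1 = Σ_{admissible Ω₁} ζ_{Ω₁ᶜ} χ_{Ω₁}, (8) where χ_{Ω₁} involves
  the characteristic functions in (7) connected with plaquettes p ∈ Ω₁, i.e. plaquettes with at least one corner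
  belonging to Ω₁. The meaning of ζ_{Ω₁ᶜ} is clear."* — PROVED in two layers: (a) for ANY rule `P ↦ Ω₁(P)` and any
  assignment `Ω₁ ↦ {plaquettes of T cornered in Ω₁}` such that no plaquette of P is cornered in Ω₁(P), the regrouping of
  (7) by the fibres of the rule is the exact identity (8) with `χ_{Ω₁} = Π_{p cornered in Ω₁} χ_<(p)`,
  `ζ_{Ω₁ᶜ} = Σ_{P : Ω₁(P) = Ω₁} Π_{p∈P} χ_≥(p) · Π_{p ∈ T∖P, p not cornered in Ω₁} χ_<(p)` and "admissible" = in the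
  image of the rule (`resummation8_eq_sum7`, `resummation8`); (b) for the PRINTED rule — sites of the unit lattice in a
  pseudometric space, `blk x` = the big block of the site x, `Ω₁(P)` = the union of the big blocks every site of which
  is at distance `> RM₁` from every corner of every plaquette of P — the separation *"p ⊂ Ω₁ᶜ, in fact
  dist(P, Ω₁) > RM₁"* is PROVED (`dist_gt_of_mem_omega1`, `disjoint_cornered_omega1`, from `dist x x = 0 ≤ RM₁`), whence
  (8) for the printed rule (`resummation8_printed`).

WHAT IS NOT HERE.  Which Ω₁ are "admissible" beyond "in the image of the rule" (print does not say more); the auxiliary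
neighbourhood Ω₀ ⊃ Ω₁ of p. 257 (narrative, no identity attached); the multi-step version of the decomposition on Λ_k
(p. 267, same identity with ε₁ = g_kp(g_k) — covered by instantiating `T`, `ε₁`); the group-valued plaquette variables
(only the real deviations `|U(∂p) − 1|` enter (7)).  The companion modules `B10LargeField` (the rule as the predicate
`Rule268` on domain sequences) and `B10LargeFieldSum` (the counting device `Σ_{Q⊆E} Π w ≤ exp Σ w` by which (8)'s sum is
later CONTROLLED) are imported by neither side and left untouched.  Certified finite bookkeeping in the paper's own
variables; no content of the series; NOT summit progress.

FILE HISTORY / v3 MERGE (2026-08-21; rulings G.5-31(d) and G.5-33(iv) of `run/shared/lean/pub/lit-balaban/PHASE2-TARGETS.md`).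
This path received two independent NEW-file landings for the same two rows: p243121 by Phase-2 seat p23 (unit
`lit-balaban-p23` gen 1; ACCEPTED, commit 6d3c0448614e) and, filed four seconds later, p243126 by the nominating reader
r07 gen 3 (ACCEPTED, commit 45300272f055) — the text of §§1–4, which became the tree head and thereby removed p243121's
thirteen declarations.  v3 = §§1–4 VERBATIM (author: unit `lit-balaban-r07` gen 3) + §5 = the p243121 declarations
restored append-only (author: seat p23 gen 1; merge by seat p23 gen 2), renamed only where §§1–4 already use the name,
identical definitions not re-declared — the dictionary heads §5.  Credit for rows B10.Eq7 / B10.Eq8 is shared between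
the two units as the fold owner r07 records it.
-/

namespace Literature.MathematicalPhysics.QuantumFieldTheory.Balaban1983to89.B10Decomposition7

open Finset
open Literature.MathematicalPhysics.QuantumFieldTheory.Balaban1983to89

/-! ## 1. (7) as a finite identity over a commutative semiring -/

section Decomposition7

variable {Pl : Type*} [DecidableEq Pl] {R : Type*} [CommSemiring R]

/-- The term of **(7)** p. 257 [3] labelled by the set `P` of (large-field) plaquettes:
`Π_{p∈P} χ({|U(∂p) − 1| ≥ ε₁}) · Π_{p∈Pᶜ} χ({|U(∂p) − 1| < ε₁})`, with `Pᶜ = T ∖ P` (*"the sum is over sets P of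
plaquettes of the lattice T"*) and the two characteristic functions kept as abstract weights `χge`, `χlt` with values
in a commutative semiring (real numbers for a fixed configuration; real functions of U for the identity between
functions). [cite: Balaban1985UV3, (7) p.257] -/
def term7 (T : Finset Pl) (χge χlt : Pl → R) (P : Finset Pl) : R :=
  (∏ p ∈ P, χge p) * ∏ p ∈ T \ P, χlt p

/-- The sum of (7) is the binomial expansion of `Π_{p∈T} (χ_≥(p) + χ_<(p))` (`Finset.prod_add`).
[cite: Balaban1985UV3, (7) p.257] -/
theorem sum_term7_eq_prod (T : Finset Pl) (χge χlt : Pl → R) :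
    ∑ P ∈ T.powerset, term7 T χge χlt P = ∏ p ∈ T, (χge p + χlt p) :=
  (Finset.prod_add χge χlt T).symm

/-- **(7)** p. 257 [3], verbatim: *"We introduce the decomposition of unity
1 = Σ_P Π_{p∈P} χ({|U(∂p) − 1| ≥ ε₁}) Π_{p∈Pᶜ} χ({|U(∂p) − 1| < ε₁}), (7) where the sum is over sets P of plaquettes
of the lattice T."*  PROVED for any two weights with `χ_≥(p) + χ_<(p) = 1` on T (the two characteristic functions of
complementary events): the sum over all `P ⊆ T` of the terms is `1`. [cite: Balaban1985UV3, (7) p.257] -/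
theorem decomposition7 (T : Finset Pl) (χge χlt : Pl → R) (h : ∀ p ∈ T, χge p + χlt p = 1) :
    ∑ P ∈ T.powerset, term7 T χge χlt P = 1 := by
  rw [sum_term7_eq_prod]
  exact Finset.prod_eq_one h

end Decomposition7

/-! ## 2. (7) for the two complementary characteristic functions of a configuration -/

section Indicator

variable {Pl : Type*}

/-- `χ({|U(∂p) − 1| ≥ ε₁})` of (7) p. 257 [3] for a FIXED configuration, as a function of the plaquette through its
deviation `dev p = |U(∂p) − 1|` (a real number per plaquette; the group-valued holonomy is not modelled, as in
`B10LargeField.Chi40`). [cite: Balaban1985UV3, (7) p.257] -/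
noncomputable def chiGe (ε₁ : ℝ) (dev : Pl → ℝ) (p : Pl) : ℝ := if ε₁ ≤ dev p then 1 else 0

/-- `χ({|U(∂p) − 1| < ε₁})` of (7) p. 257 [3] (and of (4) p. 256 [2]: *"χ is the characteristic function of the set of
configurations U satisfying the following conditions: |U(∂p) − 1| < ε₁"*), per plaquette, for a fixed configuration.
[cite: Balaban1985UV3, (7) p.257] -/
noncomputable def chiLt (ε₁ : ℝ) (dev : Pl → ℝ) (p : Pl) : ℝ := if dev p < ε₁ then 1 else 0

/-- The two characteristic functions of (7) are complementary: `χ_≥ + χ_< = 1` plaquette by plaquette.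
[cite: Balaban1985UV3, (7) p.257] -/
theorem chiGe_add_chiLt (ε₁ : ℝ) (dev : Pl → ℝ) (p : Pl) : chiGe ε₁ dev p + chiLt ε₁ dev p = 1 := by
  unfold chiGe chiLt
  by_cases h : ε₁ ≤ dev p
  · simp [h, not_lt.mpr h]
  · simp [h, lt_of_not_ge h]

/-- **(7)** p. 257 [3] for the characteristic functions themselves: for every configuration (every deviation profile
`dev = |U(∂·) − 1|`), every finite plaquette set `T` and every `ε₁`,
`Σ_{P⊆T} Π_{p∈P} χ({|U(∂p) − 1| ≥ ε₁}) Π_{p∈T∖P} χ({|U(∂p) − 1| < ε₁}) = 1`. [cite: Balaban1985UV3, (7) p.257] -/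
theorem decomposition7_indicator [DecidableEq Pl] (T : Finset Pl) (ε₁ : ℝ) (dev : Pl → ℝ) :
    ∑ P ∈ T.powerset, term7 T (chiGe ε₁ dev) (chiLt ε₁ dev) P = 1 :=
  decomposition7 T _ _ fun p _ => chiGe_add_chiLt ε₁ dev p

/-- **(7)** with the printed window, p. 257 [3]: *"We choose the number ε₁ in the same way as in the papers on the
Higgs model, i.e. we take ε₁ = g₀p(g₀), where p(g) = b₀(1 + log g⁻¹)^{p₀}, p₀ > 2 and b₀ is a sufficiently large absolute
constant"* (`B10.pFun`; at the k-th step `ε₁ = g_kp(g_k)`, p. 267 [13]). [cite: Balaban1985UV3, (7) p.257] -/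
theorem decomposition7_eps1 [DecidableEq Pl] (T : Finset Pl) (b₀ p₀ g₀ : ℝ) (dev : Pl → ℝ) :
    ∑ P ∈ T.powerset,
      term7 T (chiGe (g₀ * B10.pFun b₀ p₀ g₀) dev) (chiLt (g₀ * B10.pFun b₀ p₀ g₀) dev) P = 1 :=
  decomposition7_indicator T _ dev

/-- The large-field plaquette set of a configuration: `{p ∈ T : |U(∂p) − 1| ≥ ε₁}` — the label of the one term of (7)
that does not vanish at this configuration (p. 258 [4]: *"For each plaquette p ∈ P, where P is one of the sets occurring
in the definition of ζ_{Ω₁ᶜ}, we have … |U(∂p) − 1|² …"*; p. 273 [19]: *"a plaquette p′ ⊂ Λ_j and such that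
|V_j(∂p′) − 1| ≥ g_jp(g_j)"*). [cite: Balaban1985UV3, (7) p.257] -/
noncomputable def largeSet (T : Finset Pl) (ε₁ : ℝ) (dev : Pl → ℝ) : Finset Pl := T.filter fun p => ε₁ ≤ dev p

/-- The large-field set lies in `T`. [cite: Balaban1985UV3, (7) p.257] -/
theorem largeSet_subset (T : Finset Pl) (ε₁ : ℝ) (dev : Pl → ℝ) : largeSet T ε₁ dev ⊆ T :=
  Finset.filter_subset _ _

/-- Pointwise content of (7): at a fixed configuration the term labelled `P ⊆ T` equals `1` if `P` is the large-field
set `{p ∈ T : |U(∂p) − 1| ≥ ε₁}` of the configuration and `0` otherwise — the decomposition of unity (7) is a partition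
of configuration space according to the large-field plaquette set. [cite: Balaban1985UV3, (7) p.257] -/
theorem term7_indicator [DecidableEq Pl] (T : Finset Pl) (ε₁ : ℝ) (dev : Pl → ℝ) {P : Finset Pl} (hP : P ⊆ T) :
    term7 T (chiGe ε₁ dev) (chiLt ε₁ dev) P = if P = largeSet T ε₁ dev then 1 else 0 := by
  unfold term7
  by_cases hPL : P = largeSet T ε₁ dev
  · rw [if_pos hPL]
    have h1 : ∏ p ∈ P, chiGe ε₁ dev p = 1 := by
      refine Finset.prod_eq_one fun p hp => ?_
      have hp' : ε₁ ≤ dev p := by rw [hPL, largeSet, Finset.mem_filter] at hp; exact hp.2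
      simp [chiGe, hp']
    have h2 : ∏ p ∈ T \ P, chiLt ε₁ dev p = 1 := by
      refine Finset.prod_eq_one fun p hp => ?_
      rw [Finset.mem_sdiff] at hp
      have hp' : dev p < ε₁ := by
        by_contra hcon
        exact hp.2 (by rw [hPL, largeSet, Finset.mem_filter]; exact ⟨hp.1, not_lt.mp hcon⟩)
      simp [chiLt, hp']
    rw [h1, h2, one_mul]
  · rw [if_neg hPL]
    -- some plaquette is misclassified by `P`: either a small plaquette in `P` or a large one outside
    have hmis : (∃ p ∈ P, ¬ ε₁ ≤ dev p) ∨ ∃ p ∈ T \ P, ε₁ ≤ dev p := by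
      by_contra hcon
      push Not at hcon
      apply hPL
      ext p
      rw [largeSet, Finset.mem_filter]
      constructor
      · exact fun hp => ⟨hP hp, hcon.1 p hp⟩
      · rintro ⟨hpT, hpd⟩
        by_contra hpP
        exact absurd hpd (not_le.mpr (hcon.2 p (Finset.mem_sdiff.mpr ⟨hpT, hpP⟩)))
    rcases hmis with ⟨p, hp, hpd⟩ | ⟨p, hp, hpd⟩
    · rw [Finset.prod_eq_zero hp (by simp [chiGe, hpd]), zero_mul]
    · rw [Finset.prod_eq_zero hp (by simp [chiLt, not_lt.mpr hpd]), mul_zero]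

/-- (7) re-read through `term7_indicator`: the sum of (7) has exactly one non-zero term, the one labelled by the
large-field set, and it is `1`. [cite: Balaban1985UV3, (7) p.257] -/
theorem sum_term7_indicator_eq_single [DecidableEq Pl] (T : Finset Pl) (ε₁ : ℝ) (dev : Pl → ℝ) :
    ∑ P ∈ T.powerset, term7 T (chiGe ε₁ dev) (chiLt ε₁ dev) P
      = term7 T (chiGe ε₁ dev) (chiLt ε₁ dev) (largeSet T ε₁ dev) := by
  rw [decomposition7_indicator, term7_indicator T ε₁ dev (largeSet_subset T ε₁ dev), if_pos rfl]

end Indicator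

/-! ## 3. (8): the partial resummation over all P determining the same domain Ω₁ (any rule) -/

section Resummation8

variable {Pl : Type*} {R : Type*} [CommSemiring R] {D : Type*}

/-- `χ_{Ω₁}` of **(8)** p. 258 [4], verbatim: *"where χ_{Ω₁} involves the characteristic functions in (7) connected with
plaquettes p ∈ Ω₁, i.e. plaquettes with at least one corner belonging to Ω₁"*: the product of the small-field
characteristic functions `χ_<(p)` over the plaquettes `inner Ω₁` of T cornered in Ω₁ (these plaquettes are never in P —
hypothesis `hsep` below, the printed *"p ⊂ Ω₁ᶜ"* — so only `χ_<` factors occur). [cite: Balaban1985UV3, (8) p.258] -/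
def chiDom (χlt : Pl → R) (inner : D → Finset Pl) (Ω : D) : R := ∏ p ∈ inner Ω, χlt p

/-- `ζ_{Ω₁ᶜ}` of **(8)** p. 258 [4] (*"The meaning of ζ_{Ω₁ᶜ} is clear"*; p. 257 [3]: *"we perform a partial resummation
over all P determining the same domain Ω₁"*): the sum over the sets `P ⊆ T` with `Ω₁(P) = Ω₁` of
`Π_{p∈P} χ_≥(p) · Π_{p ∈ T∖P, p not cornered in Ω₁} χ_<(p)` — everything of the term of (7) except the factor `χ_{Ω₁}`.
`dom` = the rule `P ↦ Ω₁(P)`, `inner Ω₁` = the plaquettes of T cornered in Ω₁. [cite: Balaban1985UV3, (8) p.258] -/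
def zetaDom [DecidableEq Pl] [DecidableEq D] (T : Finset Pl) (χge χlt : Pl → R) (dom : Finset Pl → D)
    (inner : D → Finset Pl) (Ω : D) : R :=
  ∑ P ∈ T.powerset.filter (fun P => dom P = Ω), (∏ p ∈ P, χge p) * ∏ p ∈ (T \ P) \ inner Ω, χlt p

/-- The *"admissible Ω₁"* of **(8)** p. 258 [4]: the domains determined by at least one plaquette set `P ⊆ T` under the
rule `P ↦ Ω₁(P)` (print attaches no further condition to the word). [cite: Balaban1985UV3, (8) p.258] -/
def admissible [DecidableEq D] (T : Finset Pl) (dom : Finset Pl → D) : Finset D := T.powerset.image dom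

/-- The domain of every `P ⊆ T` is admissible. [cite: Balaban1985UV3, (8) p.258] -/
theorem dom_mem_admissible [DecidableEq D] (T : Finset Pl) (dom : Finset Pl → D) {P : Finset Pl} (hP : P ⊆ T) :
    dom P ∈ admissible T dom :=
  Finset.mem_image_of_mem dom (Finset.mem_powerset.mpr hP)

/-- Factorisation of one term of (7): if the plaquettes cornered in `Ω₁(P)` lie in T and none of them is in P
(p. 257 [3]: *"By this definition p ⊂ Ω₁ᶜ"*), then
`Π_{p∈P} χ_≥ · Π_{p∈T∖P} χ_< = (Π_{p∈P} χ_≥ · Π_{p∈T∖P, p not cornered in Ω₁(P)} χ_<) · χ_{Ω₁(P)}`.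
[cite: Balaban1985UV3, (8) p.258] -/
theorem term7_factor [DecidableEq Pl] (T : Finset Pl) (χge χlt : Pl → R) (dom : Finset Pl → D)
    (inner : D → Finset Pl) {P : Finset Pl} (hin : inner (dom P) ⊆ T) (hsep : Disjoint P (inner (dom P))) :
    term7 T χge χlt P
      = ((∏ p ∈ P, χge p) * ∏ p ∈ (T \ P) \ inner (dom P), χlt p) * chiDom χlt inner (dom P) := by
  have hsub : inner (dom P) ⊆ T \ P := by
    intro p hp
    exact Finset.mem_sdiff.mpr ⟨hin hp, fun hpP => Finset.disjoint_left.mp hsep hpP hp⟩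
  unfold term7 chiDom
  rw [mul_assoc, Finset.prod_sdiff hsub]

/-- **The regrouping behind (8)**, pp. 257–258 [3–4]: for ANY rule `P ↦ Ω₁(P)` whose cornered plaquettes lie in T and
avoid P, summing the terms of (7) fibre by fibre of the rule gives `Σ_{admissible Ω₁} ζ_{Ω₁ᶜ} χ_{Ω₁} = Σ_{P⊆T} (term of
(7) labelled P)` — an identity of finite sums, valid for arbitrary weights (`Finset.sum_image'`).
[cite: Balaban1985UV3, (8) p.258] -/
theorem resummation8_eq_sum7 [DecidableEq Pl] [DecidableEq D] (T : Finset Pl) (χge χlt : Pl → R)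
    (dom : Finset Pl → D) (inner : D → Finset Pl)
    (hin : ∀ P, P ⊆ T → inner (dom P) ⊆ T) (hsep : ∀ P, P ⊆ T → Disjoint P (inner (dom P))) :
    ∑ Ω ∈ admissible T dom, zetaDom T χge χlt dom inner Ω * chiDom χlt inner Ω
      = ∑ P ∈ T.powerset, term7 T χge χlt P := by
  unfold admissible
  refine Finset.sum_image' (term7 T χge χlt) fun P _ => ?_
  unfold zetaDom
  rw [Finset.sum_mul]
  refine Finset.sum_congr rfl fun Q hQ => ?_
  rw [Finset.mem_filter, Finset.mem_powerset] at hQ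
  rw [← hQ.2]
  exact (term7_factor T χge χlt dom inner (hin Q hQ.1) (hsep Q hQ.1)).symm

/-- **(8)** p. 258 [4], verbatim: *"Now we perform a partial resummation over all P determining the same domain Ω₁, and
we write the decomposition (7) as 1 = Σ_{admissible Ω₁} ζ_{Ω₁ᶜ} χ_{Ω₁}, (8) where χ_{Ω₁} involves the characteristic
functions in (7) connected with plaquettes p ∈ Ω₁, i.e. plaquettes with at least one corner belonging to Ω₁. The
meaning of ζ_{Ω₁ᶜ} is clear."*  PROVED for any rule with the separation property *"p ⊂ Ω₁ᶜ"* and any complementary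
weights `χ_≥ + χ_< = 1` on T. [cite: Balaban1985UV3, (8) p.258] -/
theorem resummation8 [DecidableEq Pl] [DecidableEq D] (T : Finset Pl) (χge χlt : Pl → R) (dom : Finset Pl → D)
    (inner : D → Finset Pl) (h7 : ∀ p ∈ T, χge p + χlt p = 1)
    (hin : ∀ P, P ⊆ T → inner (dom P) ⊆ T) (hsep : ∀ P, P ⊆ T → Disjoint P (inner (dom P))) :
    ∑ Ω ∈ admissible T dom, zetaDom T χge χlt dom inner Ω * chiDom χlt inner Ω = 1 := by
  rw [resummation8_eq_sum7 T χge χlt dom inner hin hsep, decomposition7 T χge χlt h7]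

end Resummation8

/-! ## 4. (8) for the printed rule: Ω₁(P) = the union of the big blocks at distance > RM₁ from P -/

section PrintedRule

variable {Pl : Type*} {Pt : Type*} {β : Type*}

open scoped Classical in
/-- The plaquettes of T *"with at least one corner belonging to Ω₁"* (p. 258 [4], the plaquettes whose characteristic
functions make up `χ_{Ω₁}`); `corners p` = the corner sites of the plaquette p. [cite: Balaban1985UV3, (8) p.258] -/
noncomputable def cornered (corners : Pl → Set Pt) (T : Finset Pl) (Ω : Set Pt) : Finset Pl :=
  T.filter fun p => ∃ y ∈ corners p, y ∈ Ω

/-- The cornered plaquettes lie in T. [cite: Balaban1985UV3, (8) p.258] -/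
theorem cornered_subset (corners : Pl → Set Pt) (T : Finset Pl) (Ω : Set Pt) : cornered corners T Ω ⊆ T := by
  classical
  unfold cornered
  exact Finset.filter_subset _ _

variable [PseudoMetricSpace Pt]

/-- p. 257 [3], verbatim: *"to each term of the decomposition we assign a subset Ω₁ ⊂ T₁ defined as a union of big
blocks, i.e. blocks of the size M₁, of the unit lattice T₁, such that their distances to P are > RM₁. We take
R = R₁(1 + log g₀⁻¹)^{r₀} = R₁r(g₀)."*  The big block `b` is FAR from P: every site of the block is at distance `> c`
(`c = RM₁`) from every corner of every plaquette of P.  Carrier: sites `Pt` of the unit lattice with their lattice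
(pseudo)metric, `blk x` = the big block containing the site x, `corners p` = the corner sites of the plaquette p (on the
lattice the points of a plaquette are its corners, so this is the distance between the point sets).
[cite: Balaban1985UV3, (8) p.258] -/
def FarBlock (corners : Pl → Set Pt) (blk : Pt → β) (c : ℝ) (P : Finset Pl) (b : β) : Prop :=
  ∀ x : Pt, blk x = b → ∀ p ∈ P, ∀ y ∈ corners p, c < dist x y

/-- `Ω₁ = Ω₁(P)` of p. 257 [3]: the union of the big blocks with distances to P greater than `c = RM₁` (as a set of
sites of the unit lattice T₁). [cite: Balaban1985UV3, (8) p.258] -/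
def omega1 (corners : Pl → Set Pt) (blk : Pt → β) (c : ℝ) (P : Finset Pl) : Set Pt :=
  {x | FarBlock corners blk c P (blk x)}

/-- `Ω₁(P)` is a union of big blocks: membership depends on the site only through its block.
[cite: Balaban1985UV3, (8) p.258] -/
theorem mem_omega1_of_blk_eq (corners : Pl → Set Pt) (blk : Pt → β) (c : ℝ) (P : Finset Pl) {x x' : Pt}
    (hx : x ∈ omega1 corners blk c P) (hb : blk x' = blk x) : x' ∈ omega1 corners blk c P := by
  simp only [omega1, Set.mem_setOf_eq] at hx ⊢
  rw [hb]
  exact hx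

/-- p. 257 [3], verbatim: *"By this definition p ⊂ Ω₁ᶜ, in fact dist(P, Ω₁) > RM₁"* — every site of `Ω₁(P)` is at
distance `> RM₁` from every corner of every plaquette of P. [cite: Balaban1985UV3, (8) p.258] -/
theorem dist_gt_of_mem_omega1 (corners : Pl → Set Pt) (blk : Pt → β) (c : ℝ) (P : Finset Pl) {x y : Pt} {p : Pl}
    (hx : x ∈ omega1 corners blk c P) (hp : p ∈ P) (hy : y ∈ corners p) : c < dist x y :=
  hx x rfl p hp y hy

/-- *"p ⊂ Ω₁ᶜ"* (p. 257 [3]) as the separation the resummation needs: for `RM₁ ≥ 0` no plaquette of P has a corner in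
`Ω₁(P)` (a corner y of p ∈ P inside Ω₁(P) would be at distance `dist y y = 0 > RM₁` from itself).
[cite: Balaban1985UV3, (8) p.258] -/
theorem disjoint_cornered_omega1 (corners : Pl → Set Pt) (blk : Pt → β) {c : ℝ} (hc : 0 ≤ c) (T P : Finset Pl) :
    Disjoint P (cornered corners T (omega1 corners blk c P)) := by
  classical
  rw [Finset.disjoint_left]
  intro p hpP hpc
  unfold cornered at hpc
  rw [Finset.mem_filter] at hpc
  obtain ⟨y, hy, hyΩ⟩ := hpc.2
  have h := dist_gt_of_mem_omega1 corners blk c P hyΩ hpP hy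
  rw [dist_self] at h
  exact absurd h (not_lt.mpr hc)

open scoped Classical in
/-- **(8)** p. 258 [4] for the PRINTED rule of p. 257 [3]: with `Ω₁(P)` = the union of the big blocks at distance
`> RM₁ ≥ 0` from P, `χ_{Ω₁}` = the product of `χ({|U(∂p) − 1| < ε₁})` over the plaquettes of T with a corner in Ω₁, and
`ζ_{Ω₁ᶜ}` = the resummed remainder, `Σ_{admissible Ω₁} ζ_{Ω₁ᶜ} χ_{Ω₁} = 1` for any complementary weights
`χ_≥ + χ_< = 1` on T (in particular for the two characteristic functions of every configuration, `chiGe_add_chiLt`).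
[cite: Balaban1985UV3, (8) p.258] -/
theorem resummation8_printed [DecidableEq Pl] {R : Type*} [CommSemiring R] (corners : Pl → Set Pt) (blk : Pt → β) {c : ℝ}
    (hc : 0 ≤ c) (T : Finset Pl) (χge χlt : Pl → R) (h7 : ∀ p ∈ T, χge p + χlt p = 1) :
    ∑ Ω ∈ admissible T (omega1 corners blk c),
        zetaDom T χge χlt (omega1 corners blk c) (cornered corners T) Ω * chiDom χlt (cornered corners T) Ω = 1 :=
  resummation8 T χge χlt (omega1 corners blk c) (cornered corners T) h7
    (fun _ _ => cornered_subset corners T _) (fun P _ => disjoint_cornered_omega1 corners blk hc T P)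

open scoped Classical in
/-- (8) for the printed rule and the printed characteristic functions of a configuration (`dev = |U(∂·) − 1|`,
window `ε₁`): `Σ_{admissible Ω₁} ζ_{Ω₁ᶜ}(U) χ_{Ω₁}(U) = 1` for every U. [cite: Balaban1985UV3, (8) p.258] -/
theorem resummation8_printed_indicator [DecidableEq Pl] (corners : Pl → Set Pt) (blk : Pt → β) {c : ℝ} (hc : 0 ≤ c)
    (T : Finset Pl) (ε₁ : ℝ) (dev : Pl → ℝ) :
    ∑ Ω ∈ admissible T (omega1 corners blk c),
        zetaDom T (chiGe ε₁ dev) (chiLt ε₁ dev) (omega1 corners blk c) (cornered corners T) Ω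
          * chiDom (chiLt ε₁ dev) (cornered corners T) Ω = 1 :=
  resummation8_printed corners blk hc T _ _ fun p _ => chiGe_add_chiLt ε₁ dev p

end PrintedRule

/-! ## 5. Seat p23's formulation of (7)/(8) (proposal p243121, restored — v3 merge per G.5-31(d) / G.5-33(iv))

Sections 1–4 above are the nominating reader's file (unit `lit-balaban-r07` gen 3, p243126).  This section restores,
APPEND-ONLY, the declarations of the earlier ACCEPTED landing on the same path by Phase-2 seat p23 (unit
`lit-balaban-p23` gen 1, p243121, commit 6d3c0448614e), which the new-file landing of §§1–4 removed from the tree head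
(gate note on p243126: *"removes 13 declaration(s) nothing references"*); merge by seat p23 gen 2.  The p243121 typing
differs from §§1–4 in three inessential ways, which is why both are kept: the two characteristic functions of (7) are
the explicit 0/1 reals `if ε₁ ≤ |U(∂p) − 1| then 1 else 0`, `if |U(∂p) − 1| < ε₁ then 1 else 0` (no `term7`/`chiGe`/
`chiLt` wrappers: `chiGe_eq_ite`, `chiLt_eq_ite` below are the dictionary); the separation *"p ⊂ Ω₁ᶜ"* enters the
regrouping as the single hypothesis `star (Ω₁(P)) ⊆ T ∖ P` (equivalent to the pair `hin`/`hsep` of §3 by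
`Finset.subset_sdiff`); and B10's p. 257 rule is instantiated over abstract FINITE block data (`domRule`/`starRule`: a
finite set of big blocks, block-to-plaquette distances, corner blocks) instead of the site pseudometric of §4.
DICTIONARY p243121 → v3: `admissible`, `chiDom` — identical bodies in §3, NOT re-declared; `zetaCompl` = §3's `zetaDom`
(identical body), NOT re-declared; p243121's `resummation8` (the regrouping for ARBITRARY weights) is `regrouping8` here
(the name `resummation8` is §3's `= 1` theorem); all other p243121 declarations keep their names, statements and
proofs (`sum_powerset_prod_mul_prod`, `chi_large_add_chi_small`, `decomposition7_eq_one`, `decomposition7_window`,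
`decomposition7_term_eq_one_iff`, `chiDom_eq_ite`, `resummation8_eq_one`, `domRule`, `starRule`,
`starRule_subset_sdiff`, `resummation8_rule`, `domRule_dist`). -/

/-! ### 5.1 The decomposition of unity (7), p. 257, with explicit 0/1 weights -/

section Seven

variable {ι : Type*} [DecidableEq ι]

/-- Algebraic core of **(7)** p. 257 [3]: for complementary weights `l p + s p = 1` on a finite set `T` (in print
`l = χ({|U(∂p) − 1| ≥ ε₁})`, `s = χ({|U(∂p) − 1| < ε₁})`),
`Σ_{P ⊆ T} Π_{p∈P} l(p) · Π_{p∈T∖P} s(p) = Π_{p∈T} (l(p) + s(p)) = 1` (`Finset.prod_add`, `Finset.prod_eq_one`) — the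
statement of `decomposition7` (§1) with `term7` unfolded. [cite: Balaban1985UV3, (7) p.257] -/
theorem sum_powerset_prod_mul_prod {R : Type*} [CommSemiring R] (T : Finset ι) (l s : ι → R)
    (h : ∀ p ∈ T, l p + s p = 1) :
    ∑ P ∈ T.powerset, (∏ p ∈ P, l p) * ∏ p ∈ T \ P, s p = 1 := by
  rw [← Finset.prod_add]
  exact Finset.prod_eq_one h

omit [DecidableEq ι] in
/-- The two characteristic functions of (7) are complementary: at every plaquette exactly one of
`χ({|U(∂p) − 1| ≥ ε₁})`, `χ({|U(∂p) − 1| < ε₁})` equals 1 and the other 0 (§2's `chiGe_add_chiLt` with the weights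
written out). [cite: Balaban1985UV3, (7) p.257] -/
theorem chi_large_add_chi_small (dev : ι → ℝ) (ε₁ : ℝ) (p : ι) :
    (if ε₁ ≤ dev p then (1 : ℝ) else 0) + (if dev p < ε₁ then (1 : ℝ) else 0) = 1 := by
  by_cases hp : ε₁ ≤ dev p
  · simp [hp, not_lt.mpr hp]
  · simp [hp, not_le.mp hp]

omit [DecidableEq ι] in
/-- Dictionary §2 ↔ §5: the explicit large-field weight of this section is §2's `chiGe`.
[cite: Balaban1985UV3, (7) p.257] -/
theorem chiGe_eq_ite (ε₁ : ℝ) (dev : ι → ℝ) :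
    chiGe ε₁ dev = fun p => if ε₁ ≤ dev p then (1 : ℝ) else 0 := rfl

omit [DecidableEq ι] in
/-- Dictionary §2 ↔ §5: the explicit small-field weight of this section is §2's `chiLt`.
[cite: Balaban1985UV3, (7) p.257] -/
theorem chiLt_eq_ite (ε₁ : ℝ) (dev : ι → ℝ) :
    chiLt ε₁ dev = fun p => if dev p < ε₁ then (1 : ℝ) else 0 := rfl

/-- **(7)** p. 257 [3], verbatim: *"With each positive term in the action A(U) we connect a restriction on field
variables U, which is a restriction on the corresponding plaquette variable. We introduce the decomposition of unity
1 = Σ_P Π_{p∈P} χ({|U(∂p) − 1| ≥ ε₁}) Π_{p∈Pᶜ} χ({|U(∂p) − 1| < ε₁}), (7)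
where the sum is over sets P of plaquettes of the lattice T."*  Typed at a fixed configuration U: `T` = the finite set
of plaquettes of the lattice, `dev p = |U(∂p) − 1|`, `Pᶜ = T ∖ P`, the characteristic functions as 0/1 reals; any
threshold `ε₁`.  PROVED (exact finite identity; = §2's `decomposition7_indicator` with `term7`, `chiGe`, `chiLt`
unfolded). [cite: Balaban1985UV3, (7) p.257] -/
theorem decomposition7_eq_one (T : Finset ι) (dev : ι → ℝ) (ε₁ : ℝ) :
    ∑ P ∈ T.powerset, (∏ p ∈ P, if ε₁ ≤ dev p then (1 : ℝ) else 0) *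
      ∏ p ∈ T \ P, (if dev p < ε₁ then (1 : ℝ) else 0) = 1 :=
  sum_powerset_prod_mul_prod T _ _ fun p _ => chi_large_add_chi_small dev ε₁ p

/-- (7) with the printed window of the first step, p. 257 [3], verbatim: *"We choose the number ε₁ in the same way
as in the papers on the Higgs model, i.e. we take ε₁ = g₀p(g₀), where p(g) = b₀(1 + log g⁻¹)^{p₀}, p₀ > 2 and b₀ is a
sufficiently large absolute constant."* (`B10.pFun`; at the k-th step ε₁ = g_kp(g_k), p. 267 [13]; cf. §2's
`decomposition7_eps1`). [cite: Balaban1985UV3, (7) p.257] -/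
theorem decomposition7_window (T : Finset ι) (dev : ι → ℝ) (g₀ b₀ p₀ : ℝ) :
    ∑ P ∈ T.powerset, (∏ p ∈ P, if g₀ * B10.pFun b₀ p₀ g₀ ≤ dev p then (1 : ℝ) else 0) *
      ∏ p ∈ T \ P, (if dev p < g₀ * B10.pFun b₀ p₀ g₀ then (1 : ℝ) else 0) = 1 :=
  decomposition7_eq_one T dev _

/-- In (7) exactly one term is non-zero at a given configuration: the P-term equals 1 iff `P` is THE set of
large-field plaquettes `{p ∈ T : |U(∂p) − 1| ≥ ε₁}` (and it is 0 otherwise, each factor being 0 or 1) — the sum over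
P selects the large-field set of the configuration (§2's `term7_indicator` / `largeSet` in `iff` form).
[cite: Balaban1985UV3, (7) p.257] -/
theorem decomposition7_term_eq_one_iff (T P : Finset ι) (hP : P ⊆ T) (dev : ι → ℝ) (ε₁ : ℝ) :
    (∏ p ∈ P, if ε₁ ≤ dev p then (1 : ℝ) else 0) * ∏ p ∈ T \ P, (if dev p < ε₁ then (1 : ℝ) else 0) = 1 ↔
      P = T.filter fun p => ε₁ ≤ dev p := by
  simp only [Finset.prod_boole]
  constructor
  · intro h
    by_cases hA : ∀ p ∈ P, ε₁ ≤ dev p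
    · by_cases hB : ∀ p ∈ T \ P, dev p < ε₁
      · ext p
        simp only [Finset.mem_filter]
        refine ⟨fun hp => ⟨hP hp, hA p hp⟩, fun hp => ?_⟩
        by_contra hpP
        exact absurd (hB p (Finset.mem_sdiff.mpr ⟨hp.1, hpP⟩)) (not_lt.mpr hp.2)
      · rw [if_neg hB, mul_zero] at h
        exact absurd h zero_ne_one
    · rw [if_neg hA, zero_mul] at h
      exact absurd h zero_ne_one
  · intro h
    subst h
    have hA : ∀ p ∈ T.filter (fun p => ε₁ ≤ dev p), ε₁ ≤ dev p := fun p hp => (Finset.mem_filter.mp hp).2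
    have hB : ∀ p ∈ T \ T.filter (fun p => ε₁ ≤ dev p), dev p < ε₁ := by
      intro p hp
      rw [Finset.mem_sdiff, Finset.mem_filter] at hp
      by_contra hc
      exact hp.2 ⟨hp.1, not_lt.mp hc⟩
    rw [if_pos hA, if_pos hB, mul_one]

end Seven

/-! ### 5.2 The partial resummation (8), pp. 257–258, with the separation as `star (Ω₁(P)) ⊆ T ∖ P` -/

section Eight

variable {ι σ : Type*} [DecidableEq ι] [DecidableEq σ]

omit [DecidableEq ι] [DecidableEq σ] in
/-- On 0/1 small-field factors, `χ_{Ω₁}` (§3's `chiDom`) is the characteristic function of *"plaquette variables of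
field configurations are small in a neighbourhood of Ω₁"* (p. 257 [3]): it equals 1 iff `|U(∂p) − 1| < ε₁` for every
plaquette with a corner in Ω₁, and 0 otherwise. [cite: Balaban1985UV3, (8) p.258] -/
theorem chiDom_eq_ite (dev : ι → ℝ) (ε₁ : ℝ) (star : σ → Finset ι) (Ω : σ) :
    chiDom (fun p => if dev p < ε₁ then (1 : ℝ) else 0) star Ω =
      if ∀ p ∈ star Ω, dev p < ε₁ then 1 else 0 := by
  unfold chiDom
  rw [Finset.prod_boole]

/-- **The partial resummation**, pp. 257–258 [3–4], verbatim: *"Now we perform a partial resummation over all P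
determining the same domain Ω₁, and we write the decomposition (7) as"* (8).  For ANY weights `l, s`: the sum over
P ⊆ T of the P-terms of (7) regrouped by the fibres of P ↦ Ω₁(P), with `Π_{p∈T∖P} s(p) = χ_{Ω₁} · Π_{p∈(T∖P)∖star Ω₁} s(p)`
— legitimate because no plaquette of P has a corner in Ω₁(P) (p. 257 [3]: *"By this definition p ⊂ Ω₁ᶜ, in fact
dist(P, Ω₁) > RM₁"*), hypothesis `hstar` (one inclusion; §3's `resummation8_eq_sum7` takes the equivalent pair
`hin`/`hsep`, `Finset.subset_sdiff`).  Name in p243121: `resummation8`; renamed because §3 uses that name for the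
`= 1` form; `ζ_{Ω₁ᶜ}` = §3's `zetaDom` (p243121: `zetaCompl`, same body). [cite: Balaban1985UV3, (8) p.258] -/
theorem regrouping8 {R : Type*} [CommSemiring R] (T : Finset ι) (l s : ι → R) (dom : Finset ι → σ)
    (star : σ → Finset ι) (hstar : ∀ P, P ⊆ T → star (dom P) ⊆ T \ P) :
    ∑ P ∈ T.powerset, (∏ p ∈ P, l p) * ∏ p ∈ T \ P, s p
      = ∑ Ω ∈ admissible T dom, zetaDom T l s dom star Ω * chiDom s star Ω := by
  unfold admissible zetaDom chiDom
  rw [← Finset.sum_fiberwise_of_maps_to (s := T.powerset) (t := T.powerset.image dom) (g := dom)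
    (fun P hP => Finset.mem_image_of_mem dom hP)]
  refine Finset.sum_congr rfl fun Ω _ => ?_
  rw [Finset.sum_mul]
  refine Finset.sum_congr rfl fun P hP => ?_
  rw [Finset.mem_filter, Finset.mem_powerset] at hP
  obtain ⟨hPT, hPΩ⟩ := hP
  subst hPΩ
  rw [mul_assoc, Finset.prod_sdiff (hstar P hPT)]

/-- **(8)** p. 258 [4], verbatim: *"1 = Σ_{admissible Ω₁} ζ_{Ω₁ᶜ} χ_{Ω₁}, (8)"* — for complementary weights `l + s = 1`
on T (the two characteristic functions of (7)) and any assignment P ↦ Ω₁(P) such that no plaquette of P has a corner in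
Ω₁(P) (`hstar`, p. 257 *"By this definition p ⊂ Ω₁ᶜ"*).  PROVED (exact finite identity; §3's `resummation8` is the same
identity under the hypothesis pair `hin`/`hsep`). [cite: Balaban1985UV3, (8) p.258] -/
theorem resummation8_eq_one {R : Type*} [CommSemiring R] (T : Finset ι) (l s : ι → R)
    (h : ∀ p ∈ T, l p + s p = 1) (dom : Finset ι → σ) (star : σ → Finset ι)
    (hstar : ∀ P, P ⊆ T → star (dom P) ⊆ T \ P) :
    ∑ Ω ∈ admissible T dom, zetaDom T l s dom star Ω * chiDom s star Ω = 1 := by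
  rw [← regrouping8 T l s dom star hstar, sum_powerset_prod_mul_prod T l s h]

end Eight

/-! ### 5.3 (8) for B10's own assignment P ↦ Ω₁(P), p. 257, over finite block data -/

section Rule

variable {ι β : Type*} [DecidableEq ι] [DecidableEq β]

/-- **The assignment P ↦ Ω₁(P)**, p. 257 [3], verbatim: *"Next we proceed as in [9], that is to each term of the
decomposition we assign a subset Ω₁ ⊂ T₁ defined as a union of big blocks, i.e. blocks of the size M₁, of the unit
lattice T₁, such that their distances to P are > RM₁. We take R = R₁(1 + log g₀⁻¹)^{r₀} = R₁r(g₀)."*  Typed over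
abstract geometric data: `blocks` = the finite set of big blocks of T₁, `bd B p` = the distance from the block B to the
plaquette p, `RM = RM₁`; Ω₁(P) = THE set of blocks at distance > RM₁ from every plaquette of P (maximal reading, as in
`B10LargeField.Rule268Max`; a domain is recorded as its finite set of blocks — §4's `omega1` records it as the set of
its sites instead). [cite: Balaban1985UV3, (7) p.257] -/
noncomputable def domRule (blocks : Finset β) (bd : β → ι → ℝ) (RM : ℝ) (P : Finset ι) : Finset β :=
  blocks.filter fun B => ∀ p ∈ P, RM < bd B p

/-- *"plaquettes with at least one corner belonging to Ω₁"* (p. 258 [4]): with `cb p` = the blocks containing a corner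
of the plaquette p, the plaquettes of T having a corner in a block of the domain Ω (§4's `cornered` for domains given
by blocks). [cite: Balaban1985UV3, (8) p.258] -/
def starRule (T : Finset ι) (cb : ι → Finset β) (Ω : Finset β) : Finset ι :=
  T.filter fun p => ∃ B ∈ Ω, B ∈ cb p

/-- p. 257 [3], verbatim: *"By this definition p ⊂ Ω₁ᶜ, in fact dist(P, Ω₁) > RM₁"*: no plaquette of P has a corner in
Ω₁(P) — a block containing a corner of p is at distance 0 from p (`hbd`), and `RM₁ ≥ 0`, so it is not a block of Ω₁(P).
This is the compatibility hypothesis `hstar` of `regrouping8` for B10's assignment (§4's `disjoint_cornered_omega1`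
is the site-metric counterpart). [cite: Balaban1985UV3, (7) p.257] -/
theorem starRule_subset_sdiff (T : Finset ι) (blocks : Finset β) (bd : β → ι → ℝ) (RM : ℝ) (cb : ι → Finset β)
    (hbd : ∀ p ∈ T, ∀ B ∈ cb p, bd B p = 0) (hRM : 0 ≤ RM) (P : Finset ι) :
    starRule T cb (domRule blocks bd RM P) ⊆ T \ P := by
  intro p hp
  rw [starRule, Finset.mem_filter] at hp
  obtain ⟨hpT, B, hB, hBp⟩ := hp
  rw [domRule, Finset.mem_filter] at hB
  refine Finset.mem_sdiff.mpr ⟨hpT, fun hpP => ?_⟩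
  have h := hB.2 p hpP
  rw [hbd p hpT B hBp] at h
  exact absurd h (not_lt.mpr hRM)

/-- **(8) for B10's own assignment**: with the 0/1 characteristic functions of (7) (threshold ε₁, deviations
`dev p = |U(∂p) − 1|`), Ω₁(P) = the blocks at distance > RM₁ from P (`domRule`) and χ_{Ω₁} the product over the
plaquettes with a corner in Ω₁ (`starRule`),
`1 = Σ_{admissible Ω₁} ζ_{Ω₁ᶜ} χ_{Ω₁}` — provided only that a block containing a corner of a plaquette is at distance 0
from it and `RM₁ ≥ 0`.  PROVED (§4's `resummation8_printed_indicator` is the site-metric counterpart).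
[cite: Balaban1985UV3, (8) p.258] -/
theorem resummation8_rule (T : Finset ι) (dev : ι → ℝ) (ε₁ : ℝ) (blocks : Finset β) (bd : β → ι → ℝ) (RM : ℝ)
    (cb : ι → Finset β) (hbd : ∀ p ∈ T, ∀ B ∈ cb p, bd B p = 0) (hRM : 0 ≤ RM) :
    ∑ Ω ∈ admissible T (domRule blocks bd RM),
      zetaDom T (fun p => if ε₁ ≤ dev p then (1 : ℝ) else 0) (fun p => if dev p < ε₁ then (1 : ℝ) else 0)
          (domRule blocks bd RM) (starRule T cb) Ω *
        chiDom (fun p => if dev p < ε₁ then (1 : ℝ) else 0) (starRule T cb) Ω = 1 :=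
  resummation8_eq_one T _ _ (fun p _ => chi_large_add_chi_small dev ε₁ p) _ _
    fun P _ => starRule_subset_sdiff T blocks bd RM cb hbd hRM P

omit [DecidableEq ι] [DecidableEq β] in
/-- In the term of (8) belonging to an admissible Ω₁, every P that contributes to `ζ_{Ω₁ᶜ}` lies OUTSIDE the starred
plaquettes and determines Ω₁: p. 257 [3] *"in fact dist(P, Ω₁) > RM₁"* — every block of Ω₁ = Ω₁(P) is at distance
> RM₁ from every plaquette of P (immediate from the definition of the assignment; §4: `dist_gt_of_mem_omega1`).
[cite: Balaban1985UV3, (7) p.257] -/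
theorem domRule_dist (blocks : Finset β) (bd : β → ι → ℝ) (RM : ℝ) (P : Finset ι) :
    ∀ B ∈ domRule blocks bd RM P, ∀ p ∈ P, RM < bd B p :=
  fun _ hB => (Finset.mem_filter.mp hB).2

end Rule

/-! ### 5.4 (v4, append-only, unit `lit-balaban-p23` generation 3) The step `k → k + 1`, pp. 267–268: the same resummation on the domain `Ω_k^{(k)}` with the forbidden set `P ∪ Ω_k^{(k)c}`, and the locality of `ζ_{Λ_k}`

p. 267 [13], verbatim: *"Now we do the same operations as in the first step. We introduce the decomposition of unity (7)
for the field V on the domain Λ_k, with ε₁ = g_kp(g_k)."*  p. 268 [14], verbatim: *"define the set Ω^{(k)}_{k+1} as a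
union of big blocks of the lattice T₁^{(k)}, with distances to P ∪ Ω_k^{(k)c} greater than R(g_k)M₁. We change the
definition of Λ_k, taking Λ_k = Ω_k^{(k)} ∖ Ω^{(k)}_{k+1}, and we define Λ_{k+1} = Ω^{(k+1)}_{k+1}, hence Ω^{(k)}_{k+1} =
B(Λ_{k+1}). The partial resummation over admissible P gives the function ζ_{Λ_k} defined on fields V_k restricted to
Λ_k, and the small fields characteristic function on a neighbourhood of B(Λ_{k+1}) allows us to introduce the functions
χ_{k+1} given by (41), with V instead of V_{k+1}."*  Read from the ×2 renders `…-p013-x2.png`, `…-p014-x2.png`.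

In the vocabulary of §5.3 the step-`k` assignment is §5.3's `domRule` over the SMALLER block set "blocks of `Ω_k^{(k)}`
at distance `> R(g_k)M₁` from `Ω_k^{(k)c}`" (`blocks.filter (RM < dc ·)`, `dc B` = the distance from the block `B` to
`Ω_k^{(k)c}`), with `T` = the plaquettes of the domain on which (7) is applied and `RM = R(g_k)M₁`; so (8) at step `k`
is an INSTANCE of `resummation8_rule`, and the locality sentence is a property of §3's `zetaDom` under the separation
`star (Ω(P)) ⊆ T ∖ P`.  Theorems only. -/

section StepK

variable {ι σ : Type*} [DecidableEq ι] [DecidableEq σ]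

/-- **Locality of `ζ_Ω`** (p. 268 [14]: *"The partial resummation over admissible P gives the function ζ_{Λ_k} defined on
fields V_k restricted to Λ_k"*): under the separation property (the plaquettes starred by `Ω(P)` avoid `P`), `ζ_Ω`
involves the weights of the plaquettes of `T` OUTSIDE `star Ω` only — two weight families agreeing off `star Ω` give the
same `ζ_Ω`.  (At step `k`: `T ∖ star Ω_{k+1}` = the plaquettes of `Ω_k^{(k)}` without a corner in `Ω_{k+1}^{(k)} =
B(Λ_{k+1})`, i.e. those governed by `V_k↾Λ_k`.) [cite: Balaban1985UV3, (48) p.268] -/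
theorem zetaDom_congr_off_star {R : Type*} [CommSemiring R] (T : Finset ι) (l s l' s' : ι → R)
    (dom : Finset ι → σ) (star : σ → Finset ι) (hstar : ∀ P, P ⊆ T → star (dom P) ⊆ T \ P) (Ω : σ)
    (hl : ∀ p ∈ T, p ∉ star Ω → l p = l' p) (hs : ∀ p ∈ T, p ∉ star Ω → s p = s' p) :
    zetaDom T l s dom star Ω = zetaDom T l' s' dom star Ω := by
  unfold zetaDom
  refine Finset.sum_congr rfl fun P hP => ?_
  rw [Finset.mem_filter, Finset.mem_powerset] at hP
  obtain ⟨hPT, hPΩ⟩ := hP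
  have hsub : star Ω ⊆ T \ P := hPΩ ▸ hstar P hPT
  congr 1
  · refine Finset.prod_congr rfl fun p hp => hl p (hPT hp) fun hps => ?_
    exact (Finset.mem_sdiff.mp (hsub hps)).2 hp
  · refine Finset.prod_congr rfl fun p hp => ?_
    rw [Finset.mem_sdiff, Finset.mem_sdiff] at hp
    exact hs p hp.1.1 hp.2

/-- The same for the 0/1 characteristic functions of (7): two plaquette-deviation functions `dev`, `dev'` (two field
configurations) that agree on the plaquettes of `T` without a corner in `Ω` give the same `ζ_Ω` — *"ζ_{Λ_k} defined on
fields V_k restricted to Λ_k"* (p. 268 [14]). [cite: Balaban1985UV3, (48) p.268] -/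
theorem zetaDom_indicator_local (T : Finset ι) (dev dev' : ι → ℝ) (ε₁ : ℝ) (dom : Finset ι → σ)
    (star : σ → Finset ι) (hstar : ∀ P, P ⊆ T → star (dom P) ⊆ T \ P) (Ω : σ)
    (h : ∀ p ∈ T, p ∉ star Ω → dev p = dev' p) :
    zetaDom T (fun p => if ε₁ ≤ dev p then (1 : ℝ) else 0) (fun p => if dev p < ε₁ then (1 : ℝ) else 0) dom star Ω
      = zetaDom T (fun p => if ε₁ ≤ dev' p then (1 : ℝ) else 0) (fun p => if dev' p < ε₁ then (1 : ℝ) else 0)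
          dom star Ω :=
  zetaDom_congr_off_star T _ _ _ _ dom star hstar Ω (fun p hp hps => by rw [h p hp hps])
    (fun p hp hps => by rw [h p hp hps])

variable {β : Type*} [DecidableEq β]

omit [DecidableEq ι] [DecidableEq β] in
/-- The step-`k` assignment (p. 268 [14]: *"Ω^{(k)}_{k+1} as a union of big blocks of the lattice T₁^{(k)}, with distances
to P ∪ Ω_k^{(k)c} greater than R(g_k)M₁"*) is §5.3's `domRule` over the blocks at distance `> R(g_k)M₁` from
`Ω_k^{(k)c}` (`dc B` = that distance, `RM = R(g_k)M₁`): each of its blocks is far from `Ω_k^{(k)c}` AND from every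
plaquette of `P`. [cite: Balaban1985UV3, (48) p.268] -/
theorem domRule_step_far (blocks : Finset β) (bd : β → ι → ℝ) (dc : β → ℝ) (RM : ℝ) (P : Finset ι) :
    ∀ B ∈ domRule (blocks.filter fun B => RM < dc B) bd RM P, RM < dc B ∧ ∀ p ∈ P, RM < bd B p := by
  intro B hB
  rw [domRule, Finset.mem_filter, Finset.mem_filter] at hB
  exact ⟨hB.1.2, hB.2⟩

omit [DecidableEq ι] [DecidableEq β] in
/-- Conversely a block of `Ω_k^{(k)}` (i.e. of `blocks`) at distance `> R(g_k)M₁` from `Ω_k^{(k)c}` and from every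
plaquette of `P` belongs to `Ω^{(k)}_{k+1}(P)` (maximal reading, as `B10LargeField.Rule268Max`). [cite: Balaban1985UV3, (48) p.268] -/
theorem mem_domRule_step (blocks : Finset β) (bd : β → ι → ℝ) (dc : β → ℝ) (RM : ℝ) (P : Finset ι) {B : β}
    (hB : B ∈ blocks) (hdc : RM < dc B) (hP : ∀ p ∈ P, RM < bd B p) :
    B ∈ domRule (blocks.filter fun B => RM < dc B) bd RM P := by
  rw [domRule, Finset.mem_filter, Finset.mem_filter]
  exact ⟨⟨hB, hdc⟩, hP⟩

omit [DecidableEq ι] [DecidableEq β] in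
/-- The step-`k` domains decrease: `Ω^{(k)}_{k+1}(P)` consists of blocks of `Ω_k^{(k)}` ((38) p. 266: *"Ω₁ ⊃ Ω₂ ⊃ … ⊃
Ω_k"*; `B10LargeField.nested38_of_rule268` is the site-geometric counterpart). [cite: Balaban1985UV3, (38) p.266] -/
theorem domRule_step_subset (blocks : Finset β) (bd : β → ι → ℝ) (dc : β → ℝ) (RM : ℝ) (P : Finset ι) :
    domRule (blocks.filter fun B => RM < dc B) bd RM P ⊆ blocks := fun _ hB =>
  (Finset.mem_filter.mp (Finset.mem_filter.mp hB).1).1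

/-- **(8) at the step `k → k + 1`** (pp. 267–268 [13–14]): the decomposition of unity (7) with `ε₁ = g_kp(g_k)` over
the plaquettes `T` of the domain `Ω_k^{(k)}` (deviations `dev p = |V(∂p) − 1|`), regrouped along the step-`k` assignment
`P ↦ Ω^{(k)}_{k+1}(P)` = the blocks at distance `> R(g_k)M₁` from `P ∪ Ω_k^{(k)c}`:
`1 = Σ_{admissible Ω_{k+1}} ζ_{Λ_k} χ_{Ω_{k+1}}` — *"The partial resummation over admissible P gives the function
ζ_{Λ_k} … and the small fields characteristic function on a neighbourhood of B(Λ_{k+1})"*.  An instance of §5.3's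
`resummation8_rule` (hypotheses as there: a block containing a corner of a plaquette is at distance 0 from it, and
`R(g_k)M₁ ≥ 0`).  PROVED. [cite: Balaban1985UV3, (48) p.268] -/
theorem resummation48 (T : Finset ι) (dev : ι → ℝ) (ε₁ : ℝ) (blocks : Finset β) (bd : β → ι → ℝ)
    (dc : β → ℝ) (RM : ℝ) (cb : ι → Finset β) (hbd : ∀ p ∈ T, ∀ B ∈ cb p, bd B p = 0) (hRM : 0 ≤ RM) :
    ∑ Ω ∈ admissible T (domRule (blocks.filter fun B => RM < dc B) bd RM),
      zetaDom T (fun p => if ε₁ ≤ dev p then (1 : ℝ) else 0) (fun p => if dev p < ε₁ then (1 : ℝ) else 0)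
          (domRule (blocks.filter fun B => RM < dc B) bd RM) (starRule T cb) Ω *
        chiDom (fun p => if dev p < ε₁ then (1 : ℝ) else 0) (starRule T cb) Ω = 1 :=
  resummation8_rule T dev ε₁ (blocks.filter fun B => RM < dc B) bd RM cb hbd hRM

/-- (8) at step `k` with the printed window `ε₁ = g_kp(g_k)` (`B10.pFun`; p. 267 [13]). [cite: Balaban1985UV3, (48) p.268] -/
theorem resummation48_window (T : Finset ι) (dev : ι → ℝ) (gk b₀ p₀ : ℝ) (blocks : Finset β) (bd : β → ι → ℝ)
    (dc : β → ℝ) (RM : ℝ) (cb : ι → Finset β) (hbd : ∀ p ∈ T, ∀ B ∈ cb p, bd B p = 0) (hRM : 0 ≤ RM) :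
    ∑ Ω ∈ admissible T (domRule (blocks.filter fun B => RM < dc B) bd RM),
      zetaDom T (fun p => if gk * B10.pFun b₀ p₀ gk ≤ dev p then (1 : ℝ) else 0)
          (fun p => if dev p < gk * B10.pFun b₀ p₀ gk then (1 : ℝ) else 0)
          (domRule (blocks.filter fun B => RM < dc B) bd RM) (starRule T cb) Ω *
        chiDom (fun p => if dev p < gk * B10.pFun b₀ p₀ gk then (1 : ℝ) else 0) (starRule T cb) Ω = 1 :=
  resummation48 T dev (gk * B10.pFun b₀ p₀ gk) blocks bd dc RM cb hbd hRM

/-- At step `k` the function `ζ_{Λ_k}` of an admissible `Ω_{k+1}` depends on the configuration only through the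
deviations of the plaquettes of `Ω_k^{(k)}` without a corner in `Ω_{k+1}` — *"ζ_{Λ_k} defined on fields V_k restricted
to Λ_k"* (p. 268 [14]) — for the step-`k` assignment (its separation property is §5.3's `starRule_subset_sdiff`).
[cite: Balaban1985UV3, (48) p.268] -/
theorem zetaStep_local (T : Finset ι) (dev dev' : ι → ℝ) (ε₁ : ℝ) (blocks : Finset β) (bd : β → ι → ℝ)
    (dc : β → ℝ) (RM : ℝ) (cb : ι → Finset β) (hbd : ∀ p ∈ T, ∀ B ∈ cb p, bd B p = 0) (hRM : 0 ≤ RM)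
    (Ω : Finset β) (h : ∀ p ∈ T, p ∉ starRule T cb Ω → dev p = dev' p) :
    zetaDom T (fun p => if ε₁ ≤ dev p then (1 : ℝ) else 0) (fun p => if dev p < ε₁ then (1 : ℝ) else 0)
        (domRule (blocks.filter fun B => RM < dc B) bd RM) (starRule T cb) Ω
      = zetaDom T (fun p => if ε₁ ≤ dev' p then (1 : ℝ) else 0) (fun p => if dev' p < ε₁ then (1 : ℝ) else 0)
          (domRule (blocks.filter fun B => RM < dc B) bd RM) (starRule T cb) Ω :=
  zetaDom_indicator_local T dev dev' ε₁ _ (starRule T cb)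
    (fun P _ => starRule_subset_sdiff T (blocks.filter fun B => RM < dc B) bd RM cb hbd hRM P) Ω h

end StepK

end Literature.MathematicalPhysics.QuantumFieldTheory.Balaban1983to89.B10Decomposition7
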